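import Mathlib
import Summits.NavierStokesRegularity.NavierStokesRegularity.Theorems.LerayQuarterDissipationFiniteDissipationLiouvilleLocalBalanceStretching
import Summits.NavierStokesRegularity.NavierStokesRegularity.Theorems.LerayQuarterDissipationFiniteDissipationLiouvilleEndpointSchemeApex
import Summits.NavierStokesRegularity.NavierStokesRegularity.Theorems.LerayQuarterDissipationFiniteDissipationLiouvilleEndpointSchemeFarPast
import HarnessLib

/-!
# Crux `FiniteDissipationLiouville` (stmt-NavierStokesRegularity-22144): THE STRETCHING-FORM LOCAL BALANCE,
# EVENTUAL VERSIONS, file A (bookkeeping) — scale covariance, one-slice slack, eventual closedness,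
# antitone enstrophy on half-lines

Theorems file of route `LerayQuarterDissipation` (lead prover g18; `--supports` the crux; sequel of
`…LocalBalanceStretching(Tools)`, `…EndpointSchemeApex`, `…EndpointSchemeFarPast`; companion of
`…LocalBalanceApex/…LocalBalanceFarPast`, which treat the Lamb form). Navier–Stokes regularity is NOT
proved by anything here; no summit is.

Hypothesis (physical): `⟪ω, ∇u ω⟫ ≤ |∇ω|²_F + ‖ω‖²/(4(−t))` (vortex stretching ≤ local dissipation + the
scale-invariant quarter of `‖ω‖²/(−t)`), for a KNSS-gauge Type-I field with a Type-I envelope.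

* bookkeeping: `stretchingBalance_nsRescale_from/_until`, `stretchingBalance_slack_nonneg_at`,
  `stretchingBalance_closed_eventually(_until)`, `antitoneOn_enstrophy_of_stretchingBalance_from/_until`
  (pub-ns-dss's identity `½Z' = −∫|∇Ω|²_F − ¼Z + ∫⟪Ω,∇UΩ⟫` on a half-line);
* the theorems (`not_singular_of_stretchingBalance_near_apex`, `eq_zero_of_stretchingBalance_farPast`,
  portraits) are in file B `…LocalBalanceStretchingEventual`.

HONEST FRAMING. Time-local / eventual forms of a law-free threshold about a HYPOTHETICAL object; for
the scaling-recurrent critical element nothing beyond the all-time clause follows. Nothing is removed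
from the DSS wall. Nothing here bears on Navier–Stokes regularity.

References: Koch–Nadirashvili–Seregin–Šverák, Acta Math. 203 (2009) §4; Majda–Bertozzi (2002) §1.2.
-/

noncomputable section

set_option linter.dupNamespace false

namespace Summit.NavierStokesRegularity.NavierStokesRegularity.Theorems.FiniteDissipationLiouville.LocalBalance

open MeasureTheory Set Filter Topology Metric InnerProductSpace Function Real
open scoped RealInnerProductSpace ContDiff
open Literature.Analysis Literature.Analysis.FluidPDE
open Summit.NavierStokesRegularity.NavierStokesRegularity.Theorems
open Summit.NavierStokesRegularity.NavierStokesRegularity.Theorems.GaussianGap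
open Summit.NavierStokesRegularity.NavierStokesRegularity.Theorems.SimilarityEnstrophy
open Summit.NavierStokesRegularity.NavierStokesRegularity.Theorems.RecurrentReductionD
open Summit.NavierStokesRegularity.NavierStokesRegularity.Theorems.FiniteDissipationLiouville
open Summit.NavierStokesRegularity.NavierStokesRegularity.Theorems.FiniteDissipationLiouville.CrossFlow
open Summit.NavierStokesRegularity.NavierStokesRegularity.Theorems.FiniteDissipationLiouville.EndpointScheme
open Summit.NavierStokesRegularity.NavierStokesRegularity.Theorems.FiniteDissipationLiouville.LambProduct

variable {C : ℝ} {V : ℝ → EuclideanSpace ℝ (Fin 3) → EuclideanSpace ℝ (Fin 3)}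

section Bookkeeping

/-- Scale covariance of the hypothesis on `[τ,0)`: it passes to `[τ/c², 0)` for `V_c`. [folklore] -/
theorem stretchingBalance_nsRescale_from {c θ τ : ℝ} (hc : 0 < c)
    (hP : ∀ t : ℝ, τ ≤ t → t < 0 → ∀ x, ⟪curl (V t) x, fderiv ℝ (V t) x (curl (V t) x)⟫ ≤
      θ * (frobeniusNormSq (fderiv ℝ (curl (V t)) x) + ‖curl (V t) x‖ ^ 2 / (4 * (-t)))) :
    ∀ t : ℝ, τ / c ^ 2 ≤ t → t < 0 → ∀ x, ⟪curl (nsRescale c V t) x, fderiv ℝ (nsRescale c V t) x (curl (nsRescale c V t) x)⟫ ≤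
      θ * (frobeniusNormSq (fderiv ℝ (curl (nsRescale c V t)) x) +
        ‖curl (nsRescale c V t) x‖ ^ 2 / (4 * (-t))) := by
  intro t hτt ht x
  have hct : c ^ 2 * t < 0 := mul_neg_of_pos_of_neg (by positivity) ht
  have hτ' : τ ≤ c ^ 2 * t := by
    have := mul_le_mul_of_nonneg_left hτt (le_of_lt (by positivity : (0:ℝ) < c ^ 2))
    rwa [mul_div_cancel₀ _ (by positivity : c ^ 2 ≠ 0)] at this
  have key := hP (c ^ 2 * t) hτ' hct (c • x)
  have hcurl : curl (nsRescale c V t) x = (c * c) • curl (V (c ^ 2 * t)) (c • x) := by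
    rw [curl_eq_curlCLM, fderiv_nsRescale, map_smul, ← curl_eq_curlCLM]
  rw [hcurl, fderiv_nsRescale, fderiv_curl_nsRescale, Summit.NavierStokesRegularity.ForcedUniquenessCountableJunk.frobeniusNormSq_smul,
    _root_.smul_apply, map_smul, real_inner_smul_left,
    real_inner_smul_right, real_inner_smul_right, norm_smul,
    Real.norm_of_nonneg (by positivity : (0:ℝ) ≤ c * c)]
  have ht' : 0 < -t := neg_pos.2 ht
  have h4 : (4 : ℝ) * (-t) ≠ 0 := by positivity
  have h4c : (4 : ℝ) * (-(c ^ 2 * t)) ≠ 0 := by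
    rw [show (4 : ℝ) * (-(c ^ 2 * t)) = c ^ 2 * (4 * (-t)) by ring]; positivity
  have e1 : (c * c * ‖curl (V (c ^ 2 * t)) (c • x)‖) ^ 2 / (4 * (-t)) =
      c ^ 6 * (‖curl (V (c ^ 2 * t)) (c • x)‖ ^ 2 / (4 * (-(c ^ 2 * t)))) := by
    rw [mul_div_assoc', div_eq_div_iff h4 h4c]
    ring
  rw [e1]
  have hw : 0 ≤ c ^ 6 := by positivity
  calc c * c * (c * c * (c * c *
        ⟪curl (V (c ^ 2 * t)) (c • x), fderiv ℝ (V (c ^ 2 * t)) (c • x) (curl (V (c ^ 2 * t)) (c • x))⟫))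
      = c ^ 6 * ⟪curl (V (c ^ 2 * t)) (c • x),
          fderiv ℝ (V (c ^ 2 * t)) (c • x) (curl (V (c ^ 2 * t)) (c • x))⟫ := by ring
    _ ≤ c ^ 6 * (θ * (frobeniusNormSq (fderiv ℝ (curl (V (c ^ 2 * t))) (c • x)) +
          ‖curl (V (c ^ 2 * t)) (c • x)‖ ^ 2 / (4 * (-(c ^ 2 * t))))) :=
        mul_le_mul_of_nonneg_left key hw
    _ = θ * ((c * c * c) ^ 2 * frobeniusNormSq (fderiv ℝ (curl (V (c ^ 2 * t))) (c • x)) +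
          c ^ 6 * (‖curl (V (c ^ 2 * t)) (c • x)‖ ^ 2 / (4 * (-(c ^ 2 * t))))) := by ring


/-- Scale covariance of the hypothesis on `(−∞,τ]`: it passes to `(−∞, τ/c²]` for `V_c`. [folklore] -/
theorem stretchingBalance_nsRescale_until {c θ τ : ℝ} (hc : 0 < c)
    (hP : ∀ t : ℝ, t ≤ τ → t < 0 → ∀ x, ⟪curl (V t) x, fderiv ℝ (V t) x (curl (V t) x)⟫ ≤
      θ * (frobeniusNormSq (fderiv ℝ (curl (V t)) x) + ‖curl (V t) x‖ ^ 2 / (4 * (-t)))) :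
    ∀ t : ℝ, t ≤ τ / c ^ 2 → t < 0 → ∀ x, ⟪curl (nsRescale c V t) x, fderiv ℝ (nsRescale c V t) x (curl (nsRescale c V t) x)⟫ ≤
      θ * (frobeniusNormSq (fderiv ℝ (curl (nsRescale c V t)) x) +
        ‖curl (nsRescale c V t) x‖ ^ 2 / (4 * (-t))) := by
  intro t hτt ht x
  have hct : c ^ 2 * t < 0 := mul_neg_of_pos_of_neg (by positivity) ht
  have hτ' : c ^ 2 * t ≤ τ := by
    have := mul_le_mul_of_nonneg_left hτt (le_of_lt (by positivity : (0:ℝ) < c ^ 2))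
    rwa [mul_div_cancel₀ _ (by positivity : c ^ 2 ≠ 0)] at this
  have key := hP (c ^ 2 * t) hτ' hct (c • x)
  have hcurl : curl (nsRescale c V t) x = (c * c) • curl (V (c ^ 2 * t)) (c • x) := by
    rw [curl_eq_curlCLM, fderiv_nsRescale, map_smul, ← curl_eq_curlCLM]
  rw [hcurl, fderiv_nsRescale, fderiv_curl_nsRescale, Summit.NavierStokesRegularity.ForcedUniquenessCountableJunk.frobeniusNormSq_smul,
    _root_.smul_apply, map_smul, real_inner_smul_left,
    real_inner_smul_right, real_inner_smul_right, norm_smul,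
    Real.norm_of_nonneg (by positivity : (0:ℝ) ≤ c * c)]
  have ht' : 0 < -t := neg_pos.2 ht
  have h4 : (4 : ℝ) * (-t) ≠ 0 := by positivity
  have h4c : (4 : ℝ) * (-(c ^ 2 * t)) ≠ 0 := by
    rw [show (4 : ℝ) * (-(c ^ 2 * t)) = c ^ 2 * (4 * (-t)) by ring]; positivity
  have e1 : (c * c * ‖curl (V (c ^ 2 * t)) (c • x)‖) ^ 2 / (4 * (-t)) =
      c ^ 6 * (‖curl (V (c ^ 2 * t)) (c • x)‖ ^ 2 / (4 * (-(c ^ 2 * t)))) := by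
    rw [mul_div_assoc', div_eq_div_iff h4 h4c]
    ring
  rw [e1]
  have hw : 0 ≤ c ^ 6 := by positivity
  calc c * c * (c * c * (c * c *
        ⟪curl (V (c ^ 2 * t)) (c • x), fderiv ℝ (V (c ^ 2 * t)) (c • x) (curl (V (c ^ 2 * t)) (c • x))⟫))
      = c ^ 6 * ⟪curl (V (c ^ 2 * t)) (c • x),
          fderiv ℝ (V (c ^ 2 * t)) (c • x) (curl (V (c ^ 2 * t)) (c • x))⟫ := by ring
    _ ≤ c ^ 6 * (θ * (frobeniusNormSq (fderiv ℝ (curl (V (c ^ 2 * t))) (c • x)) +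
          ‖curl (V (c ^ 2 * t)) (c • x)‖ ^ 2 / (4 * (-(c ^ 2 * t))))) :=
        mul_le_mul_of_nonneg_left key hw
    _ = θ * ((c * c * c) ^ 2 * frobeniusNormSq (fderiv ℝ (curl (V (c ^ 2 * t))) (c • x)) +
          c ^ 6 * (‖curl (V (c ^ 2 * t)) (c • x)‖ ^ 2 / (4 * (-(c ^ 2 * t))))) := by ring


/-- **One slice, slack form** (stretching): the physical hypothesis with constant `θ` at `t = −e^{−s}` makes
`θ(|∇Ω|²_F + ¼‖Ω‖²) − ⟪Ω, ∇U Ω⟫` nonnegative on the slice `s`. [folklore] -/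
theorem stretchingBalance_slack_nonneg_at {θ : ℝ} (s : ℝ)
    (hP : ∀ x, ⟪curl (V (-Real.exp (-s))) x, fderiv ℝ (V (-Real.exp (-s))) x (curl (V (-Real.exp (-s))) x)⟫ ≤
      θ * (frobeniusNormSq (fderiv ℝ (curl (V (-Real.exp (-s)))) x) +
        ‖curl (V (-Real.exp (-s))) x‖ ^ 2 / (4 * (-(-Real.exp (-s))))))
    (y : EuclideanSpace ℝ (Fin 3)) :
    0 ≤ θ * (frobeniusNormSq (fderiv ℝ (lerayVorticity V s) y) + (1 / 4) * ‖lerayVorticity V s y‖ ^ 2) -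
      ⟪lerayVorticity V s y, fderiv ℝ (lerayOrbit V s) y (lerayVorticity V s y)⟫ := by
  rw [sub_nonneg]
  have hl0 : 0 < Real.exp (-s / 2) := Real.exp_pos _
  have hk0 : 0 < Real.exp (-s) := Real.exp_pos _
  have ht0 : -Real.exp (-s) < 0 := neg_neg_of_pos hk0
  have hΩ : lerayVorticity V s y =
      Real.exp (-s) • curl (V (-Real.exp (-s))) (Real.exp (-s / 2) • y) := by
    rw [lerayVorticity_apply, curl_lerayOrbit]
  have hDU : fderiv ℝ (lerayOrbit V s) y =
      Real.exp (-s) • fderiv ℝ (V (-Real.exp (-s))) (Real.exp (-s / 2) • y) := fderiv_lerayOrbit V s y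
  have hDΩ : fderiv ℝ (lerayVorticity V s) y =
      (Real.exp (-s) * Real.exp (-s / 2)) • fderiv ℝ (curl (V (-Real.exp (-s)))) (Real.exp (-s / 2) • y) := by
    have hfun : lerayVorticity V s =
        fun z => Real.exp (-s) • curl (V (-Real.exp (-s))) (Real.exp (-s / 2) • z) := by
      funext z
      rw [lerayVorticity_apply, curl_lerayOrbit]
    rw [hfun, fderiv_const_smul_comp_smul']
  have h := hP (Real.exp (-s / 2) • y)
  rw [neg_neg] at h
  set w₀ : EuclideanSpace ℝ (Fin 3) := curl (V (-Real.exp (-s))) (Real.exp (-s / 2) • y) with hw₀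
  set L := fderiv ℝ (V (-Real.exp (-s))) (Real.exp (-s / 2) • y) with hL
  set G := fderiv ℝ (curl (V (-Real.exp (-s)))) (Real.exp (-s / 2) • y) with hG
  have hee : Real.exp (-s / 2) * Real.exp (-s / 2) = Real.exp (-s) := by
    rw [← Real.exp_add]; congr 1; ring
  have eL : ⟪lerayVorticity V s y, fderiv ℝ (lerayOrbit V s) y (lerayVorticity V s y)⟫ =
      Real.exp (-s) ^ 3 * ⟪w₀, L w₀⟫ := by
    rw [hΩ, hDU, _root_.smul_apply, map_smul, real_inner_smul_left,
      real_inner_smul_right, real_inner_smul_right]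
    ring
  have eR : frobeniusNormSq (fderiv ℝ (lerayVorticity V s) y) + (1 / 4) * ‖lerayVorticity V s y‖ ^ 2 =
      Real.exp (-s) ^ 3 * (frobeniusNormSq G + ‖w₀‖ ^ 2 / (4 * Real.exp (-s))) := by
    rw [hDΩ, Summit.NavierStokesRegularity.ForcedUniquenessCountableJunk.frobeniusNormSq_smul, hΩ, norm_smul, Real.norm_of_nonneg hk0.le]
    have e3 : Real.exp (-s) ^ 3 * (‖w₀‖ ^ 2 / (4 * Real.exp (-s))) = Real.exp (-s) ^ 2 * ‖w₀‖ ^ 2 / 4 := by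
      rw [mul_div_assoc', div_eq_div_iff (by positivity) (by norm_num)]
      ring
    calc (Real.exp (-s) * Real.exp (-s / 2)) ^ 2 * frobeniusNormSq G + 1 / 4 * (Real.exp (-s) * ‖w₀‖) ^ 2
        = Real.exp (-s) ^ 2 * (Real.exp (-s / 2) * Real.exp (-s / 2)) * frobeniusNormSq G +
            Real.exp (-s) ^ 2 * ‖w₀‖ ^ 2 / 4 := by ring
      _ = Real.exp (-s) ^ 3 * frobeniusNormSq G + Real.exp (-s) ^ 3 * (‖w₀‖ ^ 2 / (4 * Real.exp (-s))) := by
          rw [hee, e3]; ring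
      _ = Real.exp (-s) ^ 3 * (frobeniusNormSq G + ‖w₀‖ ^ 2 / (4 * Real.exp (-s))) := by ring
  rw [eL, eR, ← mul_assoc, mul_comm θ, mul_assoc]
  exact mul_le_mul_of_nonneg_left h (by positivity)


/-- Eventual KNSS-closedness, thresholds `τ_j → −∞` (hypothesis on `[τ_j, 0)`). [cite: KochNadirashviliSereginSverak2009, Prop. 4.1 (arXiv:0709.3599 p. 8)] -/
theorem stretchingBalance_closed_eventually {v : ℕ → ℝ → EuclideanSpace ℝ (Fin 3) → EuclideanSpace ℝ (Fin 3)}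
    {W : ℝ → EuclideanSpace ℝ (Fin 3) → EuclideanSpace ℝ (Fin 3)}
    (hv : ∀ j, IsTypeIAncientMild C (v j)) (hW : IsTypeIAncientMild C W)
    (hunif : ∀ n : ℕ, TendstoUniformlyOn (fun j z => v j z.1 z.2) (fun z => W z.1 z.2) atTop
      (Icc (-((n : ℝ) + 2)) (-(1 / ((n : ℝ) + 2))) ×ˢ
        closedBall (0 : EuclideanSpace ℝ (Fin 3)) ((n : ℝ) + 2)))
    (hgr : ∀ t < 0, ∀ x, Tendsto (fun j => fderiv ℝ (v j t) x) atTop (𝓝 (fderiv ℝ (W t) x)))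
    {τ : ℕ → ℝ}
    (hP : ∀ j, ∀ t : ℝ, τ j ≤ t → t < 0 → ∀ x, ⟪curl (v j t) x, fderiv ℝ (v j t) x (curl (v j t) x)⟫ ≤
        1 * (frobeniusNormSq (fderiv ℝ (curl (v j t)) x) + ‖curl (v j t) x‖ ^ 2 / (4 * (-t))))
    (hτ : Tendsto τ atTop atBot) :
    ∀ t < 0, ∀ x, ⟪curl (W t) x, fderiv ℝ (W t) x (curl (W t) x)⟫ ≤
      1 * (frobeniusNormSq (fderiv ℝ (curl (W t)) x) + ‖curl (W t) x‖ ^ 2 / (4 * (-t))) := by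
  intro t ht x
  obtain ⟨b, hb⟩ : ∃ b : ℕ → EuclideanSpace ℝ (Fin 3), ∀ j, b j = curl (v j t) x := ⟨_, fun j => rfl⟩
  obtain ⟨L, hL⟩ : ∃ L : ℕ → (EuclideanSpace ℝ (Fin 3) →L[ℝ] EuclideanSpace ℝ (Fin 3)),
      ∀ j, L j = fderiv ℝ (v j t) x := ⟨_, fun j => rfl⟩
  obtain ⟨G, hG⟩ : ∃ G : ℕ → (EuclideanSpace ℝ (Fin 3) →L[ℝ] EuclideanSpace ℝ (Fin 3)),
      ∀ j, G j = fderiv ℝ (curl (v j t)) x := ⟨_, fun j => rfl⟩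
  have htb : Tendsto b atTop (𝓝 (curl (W t) x)) :=
    (tendsto_curl_of_fderiv (hgr t ht x)).congr fun j => (hb j).symm
  have htL : Tendsto L atTop (𝓝 (fderiv ℝ (W t) x)) := (hgr t ht x).congr fun j => (hL j).symm
  have htG : Tendsto G atTop (𝓝 (fderiv ℝ (curl (W t)) x)) :=
    (tendsto_fderiv_curl_of_unif hv hW hunif ht x).congr fun j => (hG j).symm
  -- `L_j b_j → L b` (joint continuity of evaluation)
  have hLb : Tendsto (fun j => L j (b j)) atTop (𝓝 (fderiv ℝ (W t) x (curl (W t) x))) := by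
    have h := ((ContinuousLinearMap.apply ℝ (EuclideanSpace ℝ (Fin 3)) (curl (W t) x)).continuous.tendsto
      (fderiv ℝ (W t) x)).comp htL
    -- `L_j b_j - L_j b = L_j (b_j - b)`, `‖L_j‖` bounded
    have hdiff : Tendsto (fun j => L j (b j) - L j (curl (W t) x)) atTop (𝓝 0) := by
      have hbd : ∀ j, ‖L j (b j) - L j (curl (W t) x)‖ ≤ ‖L j‖ * ‖b j - curl (W t) x‖ := by
        intro j
        rw [← map_sub]
        exact (L j).le_opNorm _
      have h1 : Tendsto (fun j => ‖L j‖ * ‖b j - curl (W t) x‖) atTop (𝓝 0) := by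
        have := htL.norm.mul (tendsto_iff_norm_sub_tendsto_zero.1 htb)
        simpa using this
      exact squeeze_zero_norm hbd h1
    have hsum := h.add hdiff
    simp only [Function.comp, ContinuousLinearMap.apply_apply, add_zero] at hsum
    exact hsum.congr fun j => by abel
  have hLHS : Tendsto (fun j => ⟪b j, L j (b j)⟫) atTop
      (𝓝 ⟪curl (W t) x, fderiv ℝ (W t) x (curl (W t) x)⟫) := htb.inner hLb
  have hRHS : Tendsto (fun j => 1 * (frobeniusNormSq (G j) + ‖b j‖ ^ 2 / (4 * (-t)))) atTop
      (𝓝 (1 * (frobeniusNormSq (fderiv ℝ (curl (W t)) x) + ‖curl (W t) x‖ ^ 2 / (4 * (-t))))) :=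
    ((((continuous_frobeniusNormSq'.tendsto _).comp htG).add ((htb.norm.pow 2).div_const _))).const_mul 1
  refine le_of_tendsto_of_tendsto hLHS hRHS ?_
  filter_upwards [hτ.eventually (eventually_le_atBot t)] with j hj
  rw [hb, hL, hG]
  exact hP j t hj ht x


/-- Eventual KNSS-closedness, thresholds `τ_j → 0⁻` (hypothesis on `t ≤ τ_j`). [cite: KochNadirashviliSereginSverak2009, Prop. 4.1 (arXiv:0709.3599 p. 8)] -/
theorem stretchingBalance_closed_eventually_until {v : ℕ → ℝ → EuclideanSpace ℝ (Fin 3) → EuclideanSpace ℝ (Fin 3)}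
    {W : ℝ → EuclideanSpace ℝ (Fin 3) → EuclideanSpace ℝ (Fin 3)}
    (hv : ∀ j, IsTypeIAncientMild C (v j)) (hW : IsTypeIAncientMild C W)
    (hunif : ∀ n : ℕ, TendstoUniformlyOn (fun j z => v j z.1 z.2) (fun z => W z.1 z.2) atTop
      (Icc (-((n : ℝ) + 2)) (-(1 / ((n : ℝ) + 2))) ×ˢ
        closedBall (0 : EuclideanSpace ℝ (Fin 3)) ((n : ℝ) + 2)))
    (hgr : ∀ t < 0, ∀ x, Tendsto (fun j => fderiv ℝ (v j t) x) atTop (𝓝 (fderiv ℝ (W t) x)))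
    {τ : ℕ → ℝ}
    (hP : ∀ j, ∀ t : ℝ, t ≤ τ j → t < 0 → ∀ x, ⟪curl (v j t) x, fderiv ℝ (v j t) x (curl (v j t) x)⟫ ≤
        1 * (frobeniusNormSq (fderiv ℝ (curl (v j t)) x) + ‖curl (v j t) x‖ ^ 2 / (4 * (-t))))
    (hτ : Tendsto τ atTop (𝓝 0)) :
    ∀ t < 0, ∀ x, ⟪curl (W t) x, fderiv ℝ (W t) x (curl (W t) x)⟫ ≤
      1 * (frobeniusNormSq (fderiv ℝ (curl (W t)) x) + ‖curl (W t) x‖ ^ 2 / (4 * (-t))) := by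
  intro t ht x
  obtain ⟨b, hb⟩ : ∃ b : ℕ → EuclideanSpace ℝ (Fin 3), ∀ j, b j = curl (v j t) x := ⟨_, fun j => rfl⟩
  obtain ⟨L, hL⟩ : ∃ L : ℕ → (EuclideanSpace ℝ (Fin 3) →L[ℝ] EuclideanSpace ℝ (Fin 3)),
      ∀ j, L j = fderiv ℝ (v j t) x := ⟨_, fun j => rfl⟩
  obtain ⟨G, hG⟩ : ∃ G : ℕ → (EuclideanSpace ℝ (Fin 3) →L[ℝ] EuclideanSpace ℝ (Fin 3)),
      ∀ j, G j = fderiv ℝ (curl (v j t)) x := ⟨_, fun j => rfl⟩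
  have htb : Tendsto b atTop (𝓝 (curl (W t) x)) :=
    (tendsto_curl_of_fderiv (hgr t ht x)).congr fun j => (hb j).symm
  have htL : Tendsto L atTop (𝓝 (fderiv ℝ (W t) x)) := (hgr t ht x).congr fun j => (hL j).symm
  have htG : Tendsto G atTop (𝓝 (fderiv ℝ (curl (W t)) x)) :=
    (tendsto_fderiv_curl_of_unif hv hW hunif ht x).congr fun j => (hG j).symm
  -- `L_j b_j → L b` (joint continuity of evaluation)
  have hLb : Tendsto (fun j => L j (b j)) atTop (𝓝 (fderiv ℝ (W t) x (curl (W t) x))) := by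
    have h := ((ContinuousLinearMap.apply ℝ (EuclideanSpace ℝ (Fin 3)) (curl (W t) x)).continuous.tendsto
      (fderiv ℝ (W t) x)).comp htL
    -- `L_j b_j - L_j b = L_j (b_j - b)`, `‖L_j‖` bounded
    have hdiff : Tendsto (fun j => L j (b j) - L j (curl (W t) x)) atTop (𝓝 0) := by
      have hbd : ∀ j, ‖L j (b j) - L j (curl (W t) x)‖ ≤ ‖L j‖ * ‖b j - curl (W t) x‖ := by
        intro j
        rw [← map_sub]
        exact (L j).le_opNorm _
      have h1 : Tendsto (fun j => ‖L j‖ * ‖b j - curl (W t) x‖) atTop (𝓝 0) := by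
        have := htL.norm.mul (tendsto_iff_norm_sub_tendsto_zero.1 htb)
        simpa using this
      exact squeeze_zero_norm hbd h1
    have hsum := h.add hdiff
    simp only [Function.comp, ContinuousLinearMap.apply_apply, add_zero] at hsum
    exact hsum.congr fun j => by abel
  have hLHS : Tendsto (fun j => ⟪b j, L j (b j)⟫) atTop
      (𝓝 ⟪curl (W t) x, fderiv ℝ (W t) x (curl (W t) x)⟫) := htb.inner hLb
  have hRHS : Tendsto (fun j => 1 * (frobeniusNormSq (G j) + ‖b j‖ ^ 2 / (4 * (-t)))) atTop
      (𝓝 (1 * (frobeniusNormSq (fderiv ℝ (curl (W t)) x) + ‖curl (W t) x‖ ^ 2 / (4 * (-t))))) :=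
    ((((continuous_frobeniusNormSq'.tendsto _).comp htG).add ((htb.norm.pow 2).div_const _))).const_mul 1
  refine le_of_tendsto_of_tendsto hLHS hRHS ?_
  filter_upwards [hτ.eventually (Ioi_mem_nhds ht)] with j hj
  rw [hb, hL, hG]
  exact hP j t (le_of_lt hj) ht x


/-- **Antitone enstrophy on `[−log(−τ), ∞)` from the stretching balance on `[τ,0)`.** [folklore energy method] -/
theorem antitoneOn_enstrophy_of_stretchingBalance_from (hV : IsTypeIAncientMild C V) (hdec : HasTypeIDecay C V)
    {τ : ℝ} (hτ : τ < 0)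
    (hP : ∀ t : ℝ, τ ≤ t → t < 0 → ∀ x, ⟪curl (V t) x, fderiv ℝ (V t) x (curl (V t) x)⟫ ≤
      1 * (frobeniusNormSq (fderiv ℝ (curl (V t)) x) + ‖curl (V t) x‖ ^ 2 / (4 * (-t)))) :
    AntitoneOn (fun σ => ∫ y, ‖lerayVorticity V σ y‖ ^ 2) (Ici (-Real.log (-τ))) := by
  obtain ⟨C₁, C₂, C₃, hD1, hD2, hD3⟩ := IsTypeIAncientMild.gaugeBounds_of_hasTypeIDecay hV hdec
  have hd := fun s => similarityEnstrophy_hasDerivAt hV hD1 hD2 hD3 s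
  refine antitoneOn_of_deriv_nonpos (convex_Ici _) (fun s _ => (hd s).continuousAt.continuousWithinAt)
    (fun s _ => (hd s).differentiableAt.differentiableWithinAt) fun s hs => ?_
  rw [interior_Ici, mem_Ioi] at hs
  rw [(hd s).deriv]
  have hts : τ ≤ -Real.exp (-s) := by
    have h1 : Real.exp (-s) < Real.exp (Real.log (-τ)) := Real.exp_lt_exp.2 (by linarith)
    rw [Real.exp_log (neg_pos.2 hτ)] at h1
    linarith
  have ht0 : -Real.exp (-s) < 0 := neg_neg_of_pos (Real.exp_pos _)
  have hslice := stretchingBalance_slack_nonneg_at (V := V) (θ := 1) s (hP _ hts ht0)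
  have iF := integrable_frobeniusNormSq_fderiv_lerayVorticity hV hD2 s
  have iZ := integrable_norm_lerayVorticity_sq hV hD1 s
  have iS := integrable_inner_stretching_lerayVorticity hV hD1 s
  have iZ' : Integrable fun y => (1 / 4 : ℝ) * ‖lerayVorticity V s y‖ ^ 2 := iZ.const_mul _
  have iFZ : Integrable fun y => frobeniusNormSq (fderiv ℝ (lerayVorticity V s) y) +
      (1 / 4 : ℝ) * ‖lerayVorticity V s y‖ ^ 2 := iF.add iZ'
  have hS : ∫ y, ⟪lerayVorticity V s y, fderiv ℝ (lerayOrbit V s) y (lerayVorticity V s y)⟫ ≤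
      (∫ y, frobeniusNormSq (fderiv ℝ (lerayVorticity V s) y)) + (1 / 4) * ∫ y, ‖lerayVorticity V s y‖ ^ 2 := by
    rw [← integral_const_mul, ← integral_add iF iZ']
    refine integral_mono iS iFZ fun y => ?_
    have h := hslice y
    rw [one_mul] at h
    linarith
  nlinarith

/-- **Antitone enstrophy on `(−∞, −log(−τ)]` from the stretching balance on `(−∞,τ]`.** [folklore energy method] -/
theorem antitoneOn_enstrophy_of_stretchingBalance_until (hV : IsTypeIAncientMild C V) (hdec : HasTypeIDecay C V)
    {τ : ℝ} (hτ : τ < 0)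
    (hP : ∀ t : ℝ, t ≤ τ → t < 0 → ∀ x, ⟪curl (V t) x, fderiv ℝ (V t) x (curl (V t) x)⟫ ≤
      1 * (frobeniusNormSq (fderiv ℝ (curl (V t)) x) + ‖curl (V t) x‖ ^ 2 / (4 * (-t)))) :
    AntitoneOn (fun σ => ∫ y, ‖lerayVorticity V σ y‖ ^ 2) (Iic (-Real.log (-τ))) := by
  obtain ⟨C₁, C₂, C₃, hD1, hD2, hD3⟩ := IsTypeIAncientMild.gaugeBounds_of_hasTypeIDecay hV hdec
  have hd := fun s => similarityEnstrophy_hasDerivAt hV hD1 hD2 hD3 s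
  refine antitoneOn_of_deriv_nonpos (convex_Iic _) (fun s _ => (hd s).continuousAt.continuousWithinAt)
    (fun s _ => (hd s).differentiableAt.differentiableWithinAt) fun s hs => ?_
  rw [interior_Iic, mem_Iio] at hs
  rw [(hd s).deriv]
  have hts : -Real.exp (-s) ≤ τ := by
    have h1 : Real.exp (Real.log (-τ)) < Real.exp (-s) := Real.exp_lt_exp.2 (by linarith)
    rw [Real.exp_log (neg_pos.2 hτ)] at h1
    linarith
  have ht0 : -Real.exp (-s) < 0 := neg_neg_of_pos (Real.exp_pos _)
  have hslice := stretchingBalance_slack_nonneg_at (V := V) (θ := 1) s (hP _ hts ht0)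
  have iF := integrable_frobeniusNormSq_fderiv_lerayVorticity hV hD2 s
  have iZ := integrable_norm_lerayVorticity_sq hV hD1 s
  have iS := integrable_inner_stretching_lerayVorticity hV hD1 s
  have iZ' : Integrable fun y => (1 / 4 : ℝ) * ‖lerayVorticity V s y‖ ^ 2 := iZ.const_mul _
  have iFZ : Integrable fun y => frobeniusNormSq (fderiv ℝ (lerayVorticity V s) y) +
      (1 / 4 : ℝ) * ‖lerayVorticity V s y‖ ^ 2 := iF.add iZ'
  have hS : ∫ y, ⟪lerayVorticity V s y, fderiv ℝ (lerayOrbit V s) y (lerayVorticity V s y)⟫ ≤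
      (∫ y, frobeniusNormSq (fderiv ℝ (lerayVorticity V s) y)) + (1 / 4) * ∫ y, ‖lerayVorticity V s y‖ ^ 2 := by
    rw [← integral_const_mul, ← integral_add iF iZ']
    refine integral_mono iS iFZ fun y => ?_
    have h := hslice y
    rw [one_mul] at h
    linarith
  nlinarith

end Bookkeeping

end Summit.NavierStokesRegularity.NavierStokesRegularity.Theorems.FiniteDissipationLiouville.LocalBalance

end
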